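import Literature.AlgebraicGeometry.Motives.MixedHodgeStructureCompositionMultiplicity
import Literature.AlgebraicGeometry.Motives.MixedHodgeStructureLengthFormulas
import HarnessLib

/-!
# Jordan–Hölder multiplicities under Tate twists: `[H(j) : S(j)] = [H : S]`

Sequel to `MixedHodgeStructureCompositionMultiplicity` (the Jordan–Hölder multiplicity `[H : S] = H.multiplicity S`,
computed on any composition series, `CompositionSeries.count_eq_multiplicity`) and `MixedHodgeStructureLengthFormulas`
(§6: `S ↦ S(j)` is an isomorphism `tateTwistOrderIso` of the lattices of sub-MHS of `H` and of its Tate twist `H(j)`,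
`λ(H(j)) = λ(H)`). Cattani–El Zein–Griffiths–Lê, *Hodge Theory*, Ex. 3.2.23 (4) (p. 163): the Tate twist
`W_r H(m) = W_{r+2m} H`, `F^r H(m) = F^{r+m} H` — an automorphism of the abelian category of mixed Hodge structures
(Thm. 3.2.18), so it preserves sub-objects, quotients, composition series and composition factors; Beachy,
*Introductory Lectures on Rings and Modules*, §2.5, Def. 2.5.1 / Thm. 2.5.2 (Jordan–Hölder: the number of composition
factors isomorphic to a given simple object is an invariant).

* §1 morphisms `H₁(j) → H₂(j)` are the morphisms `H₁ → H₂` (`Hom.ofTateTwist`, inverse to the tree's `Hom.tateTwist`);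
  `H₁(j) ≅ H₂(j) ⟺ H₁ ≅ H₂` (`exists_bijective_hom_tateTwist_iff`).
* §2 **subquotients commute with Tate twists**: `B(j) / A(j) ≅ (B / A)(j)`
  (`SubMixedHodgeStructure.exists_subquotient_tateTwist_iso`, from the tree's `toMixedHodgeStructure_tateTwist` and
  `quotient_tateTwist`), hence the composition factor `B(j)/A(j)` of `H(j)` is `≅ S(j)` iff `B/A ≅ S`
  (`subquotientIsoTo_tateTwist_iff`).
* §3 the twisted composition series `CompositionSeries.tateTwist` and **`[H(j) : S(j)] = [H : S]`**
  (`multiplicity_tateTwist`; also `[H(j) : S] = [H : S(-j)]`, `[H(j) : S(k)] = [H : S(k-j)]`, `[H : S(j)] = [H(-j) : S]`).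

All statements proved; definitions with bodies (`Hom.ofTateTwist`, `CompositionSeries.tateTwist`); no named facts,
no instances.

## References

* [CattaniElZeinGriffithsLe2014] E. Cattani et al. (eds.), Hodge Theory (2014), Ex. 3.2.23 (4) (p. 163), Thm. 3.2.18,
  Lemma 3.2.20.
* [Beachy1999RingsModules] J. A. Beachy, Introductory Lectures on Rings and Modules (1999), §2.5, Def. 2.5.1, Thm. 2.5.2.
-/

noncomputable section

open scoped SetRel

namespace Literature.AlgebraicGeometry.Motives

namespace MixedHodgeStructure

universe u v w

variable {V : Type u} [AddCommGroup V] [Module ℚ V]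
variable {V' : Type v} [AddCommGroup V'] [Module ℚ V']
variable {U : Type w} [AddCommGroup U] [Module ℚ U]
variable {H : MixedHodgeStructure V} {H' : MixedHodgeStructure V'} {S : MixedHodgeStructure U}

open SubMixedHodgeStructure

/-! ### §1 Morphisms between Tate twists -/

/-- **A morphism `H(j) → H'(j)` is a morphism `H → H'`** (the same linear map: `f(W_{k} H) = f(W_{k-2j} H(j)) ⊆
W_{k-2j} H'(j) = W_k H'`, and likewise for `F`). Inverse to `Hom.tateTwist`. [cite: CattaniElZeinGriffithsLe2014, Ex. 3.2.23 (4), p. 163] -/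
def Hom.ofTateTwist {j : ℤ} (f : Hom (H.tateTwist j) (H'.tateTwist j)) : Hom H H' where
  toLinearMap := f.toLinearMap
  map_W_le k := by simpa only [tateTwist_W, sub_add_cancel] using f.map_W_le (k - 2 * j)
  map_F_le p := by simpa only [tateTwist_F, sub_add_cancel] using f.map_F_le (p - j)

/-- `Hom.ofTateTwist` does not change the underlying map. [cite: CattaniElZeinGriffithsLe2014, Ex. 3.2.23 (4), p. 163] -/
@[simp]
theorem Hom.ofTateTwist_toLinearMap {j : ℤ} (f : Hom (H.tateTwist j) (H'.tateTwist j)) :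
    f.ofTateTwist.toLinearMap = f.toLinearMap := rfl

/-- `(f(j)).ofTateTwist = f`. [cite: CattaniElZeinGriffithsLe2014, Ex. 3.2.23 (4), p. 163] -/
@[simp]
theorem Hom.ofTateTwist_tateTwist (f : Hom H H') (j : ℤ) : (f.tateTwist j).ofTateTwist = f :=
  Hom.ext rfl

/-- `(f.ofTateTwist)(j) = f`. [cite: CattaniElZeinGriffithsLe2014, Ex. 3.2.23 (4), p. 163] -/
@[simp]
theorem Hom.tateTwist_ofTateTwist {j : ℤ} (f : Hom (H.tateTwist j) (H'.tateTwist j)) : f.ofTateTwist.tateTwist j = f :=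
  Hom.ext rfl

/-- **`H(j) ≅ H'(j)` iff `H ≅ H'`.** [cite: CattaniElZeinGriffithsLe2014, Ex. 3.2.23 (4), p. 163 and Thm. 3.2.18] -/
theorem exists_bijective_hom_tateTwist_iff (j : ℤ) :
    (∃ e : Hom (H.tateTwist j) (H'.tateTwist j), Function.Bijective e.toLinearMap) ↔
      ∃ e : Hom H H', Function.Bijective e.toLinearMap :=
  ⟨fun ⟨e, he⟩ => ⟨e.ofTateTwist, he⟩, fun ⟨e, he⟩ => ⟨e.tateTwist j, he⟩⟩

/-- `H(j) ≅ H'` iff `H ≅ H'(-j)`. [cite: CattaniElZeinGriffithsLe2014, Ex. 3.2.23 (4), p. 163] -/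
theorem exists_bijective_hom_tateTwist_iff' (j : ℤ) :
    (∃ e : Hom (H.tateTwist j) H', Function.Bijective e.toLinearMap) ↔
      ∃ e : Hom H (H'.tateTwist (-j)), Function.Bijective e.toLinearMap := by
  have e : H' = (H'.tateTwist (-j)).tateTwist j := by rw [tateTwist_tateTwist, neg_add_cancel, tateTwist_zero]
  rw [← exists_bijective_hom_tateTwist_iff (H := H) (H' := H'.tateTwist (-j)) j, ← e]

/-! ### §2 Subquotients commute with Tate twists -/

section IsoHelpers

universe w₁ w₂ w₃
variable {W₁ : Type w₁} [AddCommGroup W₁] [Module ℚ W₁] {G₁ : MixedHodgeStructure W₁}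
variable {W₂ : Type w₂} [AddCommGroup W₂] [Module ℚ W₂] {G₂ : MixedHodgeStructure W₂}
variable {W₃ : Type w₃} [AddCommGroup W₃] [Module ℚ W₃] {G₃ : MixedHodgeStructure W₃}

/-- "Isomorphic" is symmetric. [cite: CattaniElZeinGriffithsLe2014, Thm. 3.2.18] -/
private theorem iso_symm (h : ∃ e : Hom G₁ G₂, Function.Bijective e.toLinearMap) :
    ∃ e : Hom G₂ G₁, Function.Bijective e.toLinearMap := by
  obtain ⟨e, he⟩ := h
  refine ⟨e.inverse he, ?_⟩
  rw [Hom.inverse_toLinearMap]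
  exact (LinearEquiv.ofBijective e.toLinearMap he).symm.bijective

/-- "Isomorphic" is transitive. [cite: CattaniElZeinGriffithsLe2014, Thm. 3.2.18] -/
private theorem iso_trans (h₁ : ∃ e : Hom G₁ G₂, Function.Bijective e.toLinearMap)
    (h₂ : ∃ e : Hom G₂ G₃, Function.Bijective e.toLinearMap) :
    ∃ e : Hom G₁ G₃, Function.Bijective e.toLinearMap := by
  obtain ⟨e₁, he₁⟩ := h₁
  obtain ⟨e₂, he₂⟩ := h₂
  refine ⟨e₂.comp e₁, ?_⟩
  rw [Hom.comp_toLinearMap, LinearMap.coe_comp]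
  exact he₂.comp he₁

/-- Equal mixed Hodge structures on one space are isomorphic (by the identity). [folklore] -/
private theorem iso_of_eq {G G' : MixedHodgeStructure W₁} (h : G = G') :
    ∃ e : Hom G G', Function.Bijective e.toLinearMap := by
  subst h
  exact ⟨Hom.id _, Function.bijective_id⟩

/-- Quotients of equal MHS by sub-MHS with the same underlying subspace are isomorphic (by the identity). [folklore] -/
private theorem quotient_iso_of_eq {G G' : MixedHodgeStructure W₁} (h : G = G') (C : SubMixedHodgeStructure G)
    (C' : SubMixedHodgeStructure G') (hC : C.toSubmodule = C'.toSubmodule) :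
    ∃ e : Hom C.quotient C'.quotient, Function.Bijective e.toLinearMap := by
  subst h
  obtain rfl : C = C' := SubMixedHodgeStructure.ext hC
  exact ⟨Hom.id _, Function.bijective_id⟩

end IsoHelpers

/-- **`B(j) / (A(j) ∩ B(j)) ≅ (B / (A ∩ B))(j)`**: the composition factor of the twisted pair is the twist of the
composition factor (same underlying quotient space, twisted induced/quotient filtrations — the tree's
`toMixedHodgeStructure_tateTwist` and `quotient_tateTwist`). [cite: CattaniElZeinGriffithsLe2014, Ex. 3.2.23 (4), p. 163]
[cite: CattaniElZeinGriffithsLe2014, Lemma 3.2.20] -/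
theorem SubMixedHodgeStructure.exists_subquotient_tateTwist_iso (A B : SubMixedHodgeStructure H) (j : ℤ) :
    ∃ e : Hom ((A.tateTwist j).comap (B.tateTwist j).subtype).quotient ((A.comap B.subtype).quotient.tateTwist j),
      Function.Bijective e.toLinearMap :=
  iso_trans
    (quotient_iso_of_eq (toMixedHodgeStructure_tateTwist B j) ((A.tateTwist j).comap (B.tateTwist j).subtype)
      ((A.comap B.subtype).tateTwist j) rfl)
    (iso_of_eq (quotient_tateTwist (A.comap B.subtype) j))

/-- **The composition factor `B(j)/A(j)` of `H(j)` is isomorphic to `S(j)` iff `B/A ≅ S`.**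
[cite: CattaniElZeinGriffithsLe2014, Ex. 3.2.23 (4), p. 163 and Thm. 3.2.18] [cite: Beachy1999RingsModules, §2.5, Def. 2.5.1] -/
theorem SubMixedHodgeStructure.subquotientIsoTo_tateTwist_iff (A B : SubMixedHodgeStructure H) (j : ℤ) :
    SubquotientIsoTo (A.tateTwist j) (B.tateTwist j) (S.tateTwist j) ↔ SubquotientIsoTo A B S :=
  ⟨fun h => (exists_bijective_hom_tateTwist_iff j).1 (iso_trans (iso_symm (exists_subquotient_tateTwist_iso A B j)) h),
    fun h => iso_trans (exists_subquotient_tateTwist_iso A B j) ((exists_bijective_hom_tateTwist_iff j).2 h)⟩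

/-- The composition-factor relation is invariant under Tate twists: `B(j)/A(j) ≅ B'(j)/A'(j)` iff `B/A ≅ B'/A'`.
[cite: CattaniElZeinGriffithsLe2014, Ex. 3.2.23 (4), p. 163 and Thm. 3.2.18] [cite: Beachy1999RingsModules, §2.5, Def. 2.5.1] -/
theorem SubMixedHodgeStructure.subquotientIso_tateTwist_iff (A B A' B' : SubMixedHodgeStructure H) (j : ℤ) :
    SubquotientIso (A.tateTwist j) (B.tateTwist j) (A'.tateTwist j) (B'.tateTwist j) ↔ SubquotientIso A B A' B' :=
  ⟨fun h => (exists_bijective_hom_tateTwist_iff j).1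
      (iso_trans (iso_trans (iso_symm (exists_subquotient_tateTwist_iso A B j)) h) (exists_subquotient_tateTwist_iso A' B' j)),
    fun h => iso_trans (iso_trans (exists_subquotient_tateTwist_iso A B j) ((exists_bijective_hom_tateTwist_iff j).2 h))
      (iso_symm (exists_subquotient_tateTwist_iso A' B' j))⟩

/-- The composition factor `B(j)/A(j)` is simple iff `B/A` is. [cite: CattaniElZeinGriffithsLe2014, Ex. 3.2.23 (4) and p. 270] -/
theorem SubMixedHodgeStructure.isSimple_subquotient_tateTwist_iff (A B : SubMixedHodgeStructure H) (j : ℤ) :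
    ((A.tateTwist j).comap (B.tateTwist j).subtype).quotient.IsSimple ↔ (A.comap B.subtype).quotient.IsSimple := by
  obtain ⟨e, he⟩ := exists_subquotient_tateTwist_iso A B j
  rw [isSimple_iff_of_bijective e he, isSimple_tateTwist_iff]

/-- `B(j)/A(j) ≅ S` iff `B/A ≅ S(-j)`. [cite: CattaniElZeinGriffithsLe2014, Ex. 3.2.23 (4), p. 163] -/
theorem SubMixedHodgeStructure.subquotientIsoTo_tateTwist_iff' (A B : SubMixedHodgeStructure H) (j : ℤ) :
    SubquotientIsoTo (A.tateTwist j) (B.tateTwist j) S ↔ SubquotientIsoTo A B (S.tateTwist (-j)) := by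
  have e : S = (S.tateTwist (-j)).tateTwist j := by rw [tateTwist_tateTwist, neg_add_cancel, tateTwist_zero]
  rw [← subquotientIsoTo_tateTwist_iff A B j, ← e]

/-! ### §3 Twisted composition series; `[H(j) : S(j)] = [H : S]` -/

/-- `S ↦ S(j)` on the terms of a chain preserves the covering relation (it is a lattice isomorphism). [folklore] -/
private def twistHom (H : MixedHodgeStructure V) (j : ℤ) :
    SetRel.Hom {(a, b) : H.subLattice × H.subLattice | a ⋖ b}
      {(a, b) : (H.tateTwist j).subLattice × (H.tateTwist j).subLattice | a ⋖ b} :=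
  ⟨H.tateTwistOrderIso j, fun hab => (apply_covBy_apply_iff (H.tateTwistOrderIso j)).2 hab⟩

/-- **The Tate twist `s(j)` of a composition series `s` of `H`**: the series `x₀(j) ⋖ x₁(j) ⋖ ⋯ ⋖ xₙ(j)` of `H(j)`.
[cite: CattaniElZeinGriffithsLe2014, Ex. 3.2.23 (4), p. 163] [cite: Beachy1999RingsModules, §2.5, Def. 2.5.1] -/
def CompositionSeries.tateTwist (s : H.CompositionSeries) (j : ℤ) : (H.tateTwist j).CompositionSeries :=
  s.map (twistHom H j)

/-- `s(j)` has the same length as `s`. [cite: Beachy1999RingsModules, §2.5, Def. 2.5.1] -/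
@[simp]
theorem CompositionSeries.tateTwist_length (s : H.CompositionSeries) (j : ℤ) : (s.tateTwist j).length = s.length := rfl

/-- The terms of `s(j)` are the twists of the terms of `s`. [cite: CattaniElZeinGriffithsLe2014, Ex. 3.2.23 (4), p. 163] -/
theorem CompositionSeries.ofElt_tateTwist_apply (s : H.CompositionSeries) (j : ℤ) (i : Fin (s.length + 1)) :
    ofElt (s.tateTwist j i) = (ofElt (s i)).tateTwist j := by
  show ofElt (H.tateTwistOrderIso j (s i)) = _
  exact SubMixedHodgeStructure.ext rfl

/-- `s(j)` starts at `0` if `s` does. [cite: Beachy1999RingsModules, §2.5, Def. 2.5.1] -/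
theorem CompositionSeries.tateTwist_head (s : H.CompositionSeries) (j : ℤ) (hb : s.head = (bot H).toElt) :
    (s.tateTwist j).head = (bot (H.tateTwist j)).toElt := by
  show H.tateTwistOrderIso j s.head = _
  rw [hb]
  exact Subtype.ext rfl

/-- `s(j)` ends at `H(j)` if `s` ends at `H`. [cite: Beachy1999RingsModules, §2.5, Def. 2.5.1] -/
theorem CompositionSeries.tateTwist_last (s : H.CompositionSeries) (j : ℤ) (ht : s.last = (top H).toElt) :
    (s.tateTwist j).last = (top (H.tateTwist j)).toElt := by
  show H.tateTwistOrderIso j s.last = _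
  rw [ht]
  exact Subtype.ext rfl

/-- **`s(j)` has as many factors `≅ S(j)` as `s` has factors `≅ S`.** [cite: Beachy1999RingsModules, §2.5, Def. 2.5.1]
[cite: CattaniElZeinGriffithsLe2014, Ex. 3.2.23 (4), p. 163] -/
theorem CompositionSeries.count_tateTwist (s : H.CompositionSeries) (j : ℤ) (S : MixedHodgeStructure U) :
    (s.tateTwist j).count (S.tateTwist j) = s.count S := by
  classical
  rw [count_eq, count_eq]
  refine Finset.sum_congr rfl fun i _ => ?_
  have e : SubquotientIsoTo (ofElt ((s.tateTwist j) i.castSucc)) (ofElt ((s.tateTwist j) i.succ)) (S.tateTwist j) ↔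
      SubquotientIsoTo (ofElt (s (Fin.castSucc (i : Fin s.length)))) (ofElt (s (Fin.succ (i : Fin s.length)))) S := by
    rw [show (s.tateTwist j) i.castSucc = (s.tateTwist j) (Fin.castSucc (i : Fin s.length)) from rfl,
      show (s.tateTwist j) i.succ = (s.tateTwist j) (Fin.succ (i : Fin s.length)) from rfl,
      ofElt_tateTwist_apply, ofElt_tateTwist_apply, subquotientIsoTo_tateTwist_iff]
    exact Iff.rfl
  by_cases hc : SubquotientIsoTo (ofElt (s (Fin.castSucc (i : Fin s.length)))) (ofElt (s (Fin.succ (i : Fin s.length)))) S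
  · rw [if_pos (e.2 hc), if_pos hc]
  · rw [if_neg (mt e.1 hc), if_neg hc]

/-- **Jordan–Hölder multiplicities are invariant under Tate twists: `[H(j) : S(j)] = [H : S]`.**
[cite: Beachy1999RingsModules, §2.5, Def. 2.5.1 and Thm. 2.5.2] [cite: CattaniElZeinGriffithsLe2014, Ex. 3.2.23 (4), p. 163 and Thm. 3.2.18] -/
theorem multiplicity_tateTwist [FiniteDimensional ℚ V] (H : MixedHodgeStructure V) (j : ℤ) (S : MixedHodgeStructure U) :
    (H.tateTwist j).multiplicity (S.tateTwist j) = H.multiplicity S := by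
  obtain ⟨t, h₁, h₂⟩ := exists_compositionSeries H
  rw [← t.count_eq_multiplicity h₁ h₂, ← (t.tateTwist j).count_eq_multiplicity (t.tateTwist_head j h₁) (t.tateTwist_last j h₂),
    CompositionSeries.count_tateTwist]

/-- `[H(j) : S] = [H : S(-j)]`. [cite: Beachy1999RingsModules, §2.5, Thm. 2.5.2] [cite: CattaniElZeinGriffithsLe2014, Ex. 3.2.23 (4), p. 163] -/
theorem multiplicity_tateTwist' [FiniteDimensional ℚ V] (H : MixedHodgeStructure V) (j : ℤ) (S : MixedHodgeStructure U) :
    (H.tateTwist j).multiplicity S = H.multiplicity (S.tateTwist (-j)) := by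
  have e : S = (S.tateTwist (-j)).tateTwist j := by rw [tateTwist_tateTwist, neg_add_cancel, tateTwist_zero]
  rw [← multiplicity_tateTwist H j (S.tateTwist (-j)), ← e]

/-- **`[H(j) : S(k)] = [H : S(k - j)]`.** [cite: Beachy1999RingsModules, §2.5, Thm. 2.5.2] [cite: CattaniElZeinGriffithsLe2014, Ex. 3.2.23 (4), p. 163] -/
theorem multiplicity_tateTwist_tateTwist [FiniteDimensional ℚ V] (H : MixedHodgeStructure V) (j k : ℤ) (S : MixedHodgeStructure U) :
    (H.tateTwist j).multiplicity (S.tateTwist k) = H.multiplicity (S.tateTwist (k - j)) := by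
  rw [multiplicity_tateTwist', tateTwist_tateTwist, ← sub_eq_add_neg]

/-- `[H : S(j)] = [H(-j) : S]`. [cite: Beachy1999RingsModules, §2.5, Thm. 2.5.2] [cite: CattaniElZeinGriffithsLe2014, Ex. 3.2.23 (4), p. 163] -/
theorem multiplicity_tateTwist_right [FiniteDimensional ℚ V] (H : MixedHodgeStructure V) (j : ℤ) (S : MixedHodgeStructure U) :
    H.multiplicity (S.tateTwist j) = (H.tateTwist (-j)).multiplicity S := by
  rw [multiplicity_tateTwist', neg_neg]

/-- The multiplicity of the Tate structure `ℚ(i)` in `H(j)` is that of `ℚ(i)(-j)` (`= ℚ(i - j)` as an MHS) in `H`.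
[cite: CattaniElZeinGriffithsLe2014, Ex. 3.2.23 (1), (4)] -/
theorem multiplicity_tateTwist_tate [FiniteDimensional ℚ V] (H : MixedHodgeStructure V) (i j : ℤ) :
    (H.tateTwist j).multiplicity (HodgeStructure.tate i).toMixedHodgeStructure =
      H.multiplicity ((HodgeStructure.tate i).toMixedHodgeStructure.tateTwist (-j)) :=
  multiplicity_tateTwist' H j _

end MixedHodgeStructure

end Literature.AlgebraicGeometry.Motives
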